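import Mathlib

/-!
# V4U exit definitions: the presentation of the `½(1,1,1)` cone and its six generator symbols

(crux stmt-ResolutionOfSingularities-15640 `WildQuotients.WildQuotientResolution`, line `Sketch`,
sector `|G| = p`; programme V4U of `L/w45c/CHAIN.md` v6 §4 row stub-4 «C4½
`coneHalf_affineBlowup_isRegular`» / `V4U-DESIGN.md` §2: over the `μ₂`-vertex curve the quotient
piece is `(½(1,1,1)-cone × 𝔸)_Q`, cone generators `{s², sA, sN, A², AN, N²}`; ONE blow-up of the
ideal of the six generators resolves it (stub-4 FINDING V4U-μ₃/μ₂-EXIT). [OURS · L1 W4.5c] — NOT a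
statement of any manuscript; replaces the role of no printed item. Owner res-L1-w45c-stub-4.)

As for `Third112`: a PRESENTATION `k[Y] → k[x]` on the symbols `Y = Fin n ⊕ Fin 3`
(`inl a, inl b, inl c ↦ y₁², y₂², y₃²` with `(y₁, y₂, y₃) = (X a, X b, X c) = (s, A, N)`; `inl i ↦ X i`
passengers; `inr 0, 1, 2 ↦ y₁y₂, y₁y₃, y₂y₃`); the presented ring is `k[Y] ⧸ ker`
(`≅ R₂ ⊗ k[passengers]`, `R₂ = k[yᵢyⱼ]`, by `RingHom.quotientKerEquivRange`).

* `Half111.presentation k n a b c` — the presentation `k[Y] →ₐ[k] k[x]`.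
* `Half111.gens k n a b c : Fin 6 → k[Y]` — the six generator symbols in the order of record
  `s², sA, sN, A², AN, N²` (Newton vertices `0, 3, 5`; edge points `1, 2, 4`).
-/

-- single-problem summit: the doubled namespace component `ResolutionOfSingularities` is forced
set_option linter.dupNamespace false

noncomputable section

open MvPolynomial

namespace Summit.ResolutionOfSingularities.ResolutionOfSingularities.Theorems.WildQuotientResolution.Half111

/-- The presentation `k[Y] → k[x]` of `R₂ ⊗ k[passengers]`, `Y = Fin n ⊕ Fin 3`:
`inl a ↦ (X a)²`, `inl b ↦ (X b)²`, `inl c ↦ (X c)²`, `inl i ↦ X i` otherwise,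
`inr 0 ↦ X a X b`, `inr 1 ↦ X a X c`, `inr 2 ↦ X b X c`. [OURS · L1 W4.5c] -/
def presentation (k : Type) [Field k] (n : ℕ) (a b c : Fin n) :
    MvPolynomial (Fin n ⊕ Fin 3) k →ₐ[k] MvPolynomial (Fin n) k :=
  MvPolynomial.aeval (Sum.elim
    (fun i => if i = a then X a ^ 2 else if i = b then X b ^ 2 else if i = c then X c ^ 2 else X i)
    (![X a * X b, X a * X c, X b * X c] : Fin 3 → MvPolynomial (Fin n) k))

/-- The six generator symbols in the order of record `s², sA, sN, A², AN, N²`. [OURS · L1 W4.5c] -/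
def gens (k : Type) [Field k] (n : ℕ) (a b c : Fin n) : Fin 6 → MvPolynomial (Fin n ⊕ Fin 3) k :=
  ![X (Sum.inl a), X (Sum.inr 0), X (Sum.inr 1), X (Sum.inl b), X (Sum.inr 2), X (Sum.inl c)]

section Simp

variable (k : Type) [Field k] (n : ℕ) (a b c : Fin n)

/-- `Y_{inl a} ↦ y₁²`. [folklore] -/
theorem presentation_inl_a : presentation k n a b c (X (Sum.inl a)) = X a ^ 2 := by
  simp [presentation]

/-- `Y_{inl b} ↦ y₂²` (`a ≠ b`). [folklore] -/
theorem presentation_inl_b (hab : a ≠ b) : presentation k n a b c (X (Sum.inl b)) = X b ^ 2 := by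
  simp [presentation, hab.symm]

/-- `Y_{inl c} ↦ y₃²` (`a ≠ c`, `b ≠ c`). [folklore] -/
theorem presentation_inl_c (hac : a ≠ c) (hbc : b ≠ c) :
    presentation k n a b c (X (Sum.inl c)) = X c ^ 2 := by
  simp [presentation, hac.symm, hbc.symm]

/-- `Y_{inl i} ↦ X i` for a passenger `i ≠ a, b, c`. [folklore] -/
theorem presentation_inl_of_ne (i : Fin n) (hia : i ≠ a) (hib : i ≠ b) (hic : i ≠ c) :
    presentation k n a b c (X (Sum.inl i)) = X i := by
  simp [presentation, hia, hib, hic]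

/-- `Y_{inr 0} ↦ y₁ y₂`. [folklore] -/
theorem presentation_inr_zero : presentation k n a b c (X (Sum.inr 0)) = X a * X b := by
  simp [presentation]

/-- `Y_{inr 1} ↦ y₁ y₃`. [folklore] -/
theorem presentation_inr_one : presentation k n a b c (X (Sum.inr 1)) = X a * X c := by
  simp [presentation]

/-- `Y_{inr 2} ↦ y₂ y₃`. [folklore] -/
theorem presentation_inr_two : presentation k n a b c (X (Sum.inr 2)) = X b * X c := by
  simp [presentation]

/-- The presentation on the six generator symbols (`a, b, c` distinct). [folklore] -/
theorem presentation_gens (hab : a ≠ b) (hbc : b ≠ c) (hac : a ≠ c) (l : Fin 6) :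
    presentation k n a b c (gens k n a b c l) =
      (![X a ^ 2, X a * X b, X a * X c, X b ^ 2, X b * X c, X c ^ 2] :
        Fin 6 → MvPolynomial (Fin n) k) l := by
  fin_cases l
  · simpa [gens] using presentation_inl_a k n a b c
  · simpa [gens] using presentation_inr_zero k n a b c
  · simpa [gens] using presentation_inr_one k n a b c
  · simpa [gens] using presentation_inl_b k n a b c hab
  · simpa [gens] using presentation_inr_two k n a b c
  · simpa [gens] using presentation_inl_c k n a b c hac hbc

/-- Two symbols with the same image under the presentation have the same class in `k[Y]/ker`.
[folklore] -/
theorem mk_eq_of_presentation_eq {F G : MvPolynomial (Fin n ⊕ Fin 3) k}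
    (h : presentation k n a b c F = presentation k n a b c G) :
    Ideal.Quotient.mk (RingHom.ker (presentation k n a b c)) F =
      Ideal.Quotient.mk (RingHom.ker (presentation k n a b c)) G := by
  rw [Ideal.Quotient.eq, RingHom.mem_ker, map_sub, sub_eq_zero]
  exact h

end Simp

end Summit.ResolutionOfSingularities.ResolutionOfSingularities.Theorems.WildQuotientResolution.Half111

end
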